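import Mathlib
import HarnessLib
import Summits.Ventures.LatticeQCDFlow.Exactness.NCMCGeneralSpaceDoeblinPowerCLT
import Summits.Ventures.LatticeQCDFlow.Exactness.NCMCGeneralSpaceOccupancyChainErrorBars
import Summits.Ventures.LatticeQCDFlow.Exactness.NCMCGeneralSpaceDeltaMethod

/-!
# The MCMC error bar `√(2 τ_int π(A)(1 − π(A)) / n)` of an event frequency is asymptotically exact: `√n (p̂_n(A) − π(A)) ⇒ N(0, 2 τ_int(ρ_A) π(A)(1 − π(A)))` for every chain with a Doeblin power, from every initial law; and the logit

HONEST FRAMING: exact (Metropolis-corrected) sampling algorithms for lattice gauge theory;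
figures of merit are autocorrelation/cost numbers at stated couplings and volumes; no
continuum-physics claim.

Venture `LatticeQCDFlow` (cell pub-lqcd), topic `Exactness`; FANOUT row 13 (`eng-snf`, GEN-19).
NEW WORK of the cell, not a published result; no definition is introduced; nothing is cited as a
fact (the integrated-autocorrelation-time form of the CLT variance — Madras–Sokal 1988, Sokal 1997
lecture notes §2 — and the delta method are NAMED ONLY).  Specialisation of GEN-19's Markov-chain
CLT under a Doeblin power (`NCMCGeneralSpaceDoeblinPowerCLT.tendstoInDistribution_timeAverage_of_nHit`)
to the INDICATOR of an event `A`, with the variance rewritten on the tree's objects: row 9's event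
autocovariance / autocorrelation `setAutocov`, `setACF` (`Exactness/DoeblinAutocovariance.lean`,
`Exactness/DoeblinTauInt.lean`) and the scorers' `Scoring.tauInt` (`Scoring/CalibrationTruths.lean`);
the logit version by GEN-14's delta method (`NCMCGeneralSpaceDeltaMethod.tendstoInDistribution_sqrt_mul_delta`).
Engine reading: the sector / level-occupancy frequencies a seat reports from ONE run of a chain
with a Doeblin power carry the textbook error bar `√(p̂(1 − p̂) 2τ_int/n)` as an asymptotically EXACT
(not merely conservative) statement — the NCMC lane instance is `NCMCGeneralSpaceOccupancyChainCLT`.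

## Content (`κ` Markov on `S`, `π` invariant, `(nHit κ m)(z,·) ≥ ε ν` (`ε ≠ 0`, `0 < m`),
## `A` measurable with `0 < π(A) < 1`, `ρ_A = setACF κ π A`, `p̂_n = (1/n) Σ_{t<n} 1_A(x_t)`)

* `autocov_centredIndicator_eq_setAutocov` — `Scoring.autocov κ π (1_A − π(A)) t = setAutocov κ π t A A`;
  **`greenKubo_indicator_eq_tauInt`** — the Green–Kubo variance of `1_A` IS
  `2 τ_int(ρ_A) · π(A)(1 − π(A))` (`Scoring.tauInt ρ = 1/2 + Σ_{t≥1} ρ_t`);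
  `sqrt_mul_mean_sub_eq` — `√n (p̂_n − p) = (√n)⁻¹ Σ_{t<n} (1_A(x_t) − p)` (bookkeeping).
* **`tendstoInDistribution_indicator_timeAverage_of_nHit`** — for EVERY initial law `μ₀` and every
  `Y ~ N(0, 2 τ_int(ρ_A) π(A)(1 − π(A)))`:
  `TendstoInDistribution (fun n x => √n (p̂_n(x) − π(A))) atTop Y (fun _ => P_{μ₀}) P'`.
* `hasDerivAt_logit`, **`tendstoInDistribution_logit_timeAverage_of_nHit`** — the LOGIT:
  `√n (log(p̂_n/(1 − p̂_n)) − log(π(A)/(1 − π(A)))) ⇒ N(0, 2 τ_int(ρ_A) / (π(A)(1 − π(A))))`.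

NOT CLAIMED: a consistent estimator of `τ_int` (the interval is exact only with the population
`τ_int`; GEN-18's bound `τ_int(ρ_A) ≤ 1/2 + (m/ε − 1)/(1 − π(A))` makes it conservative-computable);
rates; `π(A) ∈ {0, 1}`.
-/

namespace Summit.Ventures.LatticeQCDFlow.Exactness.GeneralNCMC

open MeasureTheory ProbabilityTheory Set Filter Finset
open scoped ENNReal Topology

variable {S : Type*} [MeasurableSpace S]

/-! ## §1 The Green–Kubo variance of an indicator is `2 τ_int π(A)(1 − π(A))` -/

section Variance

variable {κ : Kernel S S} [IsMarkovKernel κ] {π : Measure S} [IsProbabilityMeasure π]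

/-- `Scoring.autocov κ π (1_A − π(A)) t = setAutocov κ π t A A` (row 8's observable autocovariance of
the centred indicator is row 9's event autocovariance). -/
theorem autocov_centredIndicator_eq_setAutocov (hπ : Kernel.Invariant κ π) {A : Set S}
    (hA : MeasurableSet A) (t : ℕ) :
    Scoring.autocov κ π (fun x => A.indicator (1 : S → ℝ) x - π.real A) t = setAutocov κ π t A A := by
  haveI := isMarkovKernel_nHit κ t
  rw [Scoring.autocov_centredIndicator_eq_stayMass hπ hA t, setAutocov_eq_setIntegral t hA hA]
  have hmeas : Measurable fun x => (nHit κ t x).real A :=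
    (Kernel.measurable_coe _ hA).ennreal_toReal
  have hint : Integrable (fun x => (nHit κ t x).real A) (π.restrict A) :=
    (integrable_const (1 : ℝ)).mono' hmeas.aestronglyMeasurable
      (ae_of_all _ fun x => by
        rw [Real.norm_eq_abs, abs_of_nonneg measureReal_nonneg]
        exact measureReal_le_one)
  rw [integral_sub hint (integrable_const _), setIntegral_const, smul_eq_mul, sq]

/-- **The Green–Kubo variance of an indicator is `2 τ_int(ρ_A) · π(A)(1 − π(A))`**:
`∫ (1_A − π(A))² dπ + 2 Σ_{k≥0} ∫ (1_A − π(A)) · κ^{k+1}(1_A − π(A)) dπ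
 = 2 · Scoring.tauInt (setACF κ π A) · (π(A)(1 − π(A)))` for `0 < π(A) < 1`. -/
theorem greenKubo_indicator_eq_tauInt (hπ : Kernel.Invariant κ π) {A : Set S}
    (hA : MeasurableSet A) (h0 : 0 < π.real A) (h1 : π.real A < 1) :
    (∫ y, (A.indicator (1 : S → ℝ) y - ∫ z, A.indicator (1 : S → ℝ) z ∂π) ^ 2 ∂π)
      + 2 * ∑' k, ∫ y, (A.indicator (1 : S → ℝ) y - ∫ z, A.indicator (1 : S → ℝ) z ∂π)
        * (Scoring.kop κ)^[k + 1] (fun y => A.indicator (1 : S → ℝ) y - ∫ z, A.indicator (1 : S → ℝ) z ∂π) y ∂π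
      = 2 * Scoring.tauInt (setACF κ π A) * (π.real A * (1 - π.real A)) := by
  rw [integral_indicator_one hA]
  have hv : setAutocov κ π 0 A A = π.real A * (1 - π.real A) := setAutocov_zero hA
  have hv0 : setAutocov κ π 0 A A ≠ 0 := by rw [hv]; exact (mul_pos h0 (sub_pos.2 h1)).ne'
  -- lag zero
  have hzero : ∫ y, (A.indicator (1 : S → ℝ) y - π.real A) ^ 2 ∂π = π.real A * (1 - π.real A) := by
    rw [← hv, ← autocov_centredIndicator_eq_setAutocov hπ hA 0]
    unfold Scoring.autocov
    simp only [Function.iterate_zero, id_eq]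
    exact integral_congr_ae (ae_of_all _ fun y => by ring)
  -- positive lags
  have hlag : ∀ k, ∫ y, (A.indicator (1 : S → ℝ) y - π.real A)
      * (Scoring.kop κ)^[k + 1] (fun y => A.indicator (1 : S → ℝ) y - π.real A) y ∂π
      = setACF κ π A (k + 1) * (π.real A * (1 - π.real A)) := by
    intro k
    rw [← hv, setACF, div_mul_cancel₀ _ hv0, ← autocov_centredIndicator_eq_setAutocov hπ hA (k + 1)]
    rfl
  simp_rw [hzero, hlag]
  rw [tsum_mul_right, Scoring.tauInt]
  ring

end Variance

/-! ## §2 The event-frequency CLT under a Doeblin power -/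

section EventCLT

omit [MeasurableSpace S] in
/-- Bookkeeping: `√n (p̂_n − p) = (√n)⁻¹ Σ_{t<n} (a_t − p)` with `p̂_n = (Σ_{t<n} a_t)/n` (both sides
vanish at `n = 0`). -/
theorem sqrt_mul_mean_sub_eq (a : ℕ → ℝ) (p : ℝ) (n : ℕ) :
    Real.sqrt n * ((∑ t ∈ range n, a t) / n - p) = (Real.sqrt n)⁻¹ * ∑ t ∈ range n, (a t - p) := by
  rcases Nat.eq_zero_or_pos n with hn | hn
  · subst hn; simp
  · have hn' : (0 : ℝ) < n := by exact_mod_cast hn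
    have hn0 : (n : ℝ) ≠ 0 := hn'.ne'
    have hs : Real.sqrt n ≠ 0 := (Real.sqrt_pos.2 hn').ne'
    rw [Finset.sum_sub_distrib, Finset.sum_const, Finset.card_range, nsmul_eq_mul]
    have key : (Real.sqrt n)⁻¹ = Real.sqrt n / n := by
      rw [eq_div_iff hn0, inv_mul_eq_iff_eq_mul₀ hs]
      exact (Real.mul_self_sqrt hn'.le).symm
    rw [key, div_mul_eq_mul_div, mul_sub, mul_sub, sub_div, mul_div_assoc, mul_div_assoc,
      mul_div_cancel_left₀ _ hn0]

variable {κ : Kernel S S} [IsMarkovKernel κ] {π : Measure S} [IsProbabilityMeasure π]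
  {ν : Measure S} [IsProbabilityMeasure ν] {ε : ℝ≥0∞} {m : ℕ}

/-- **THE EVENT-FREQUENCY CLT.**  `κ` Markov with invariant probability `π` and a Doeblin power
`(nHit κ m)(z, ·) ≥ ε ν` (`ε ≠ 0`, `0 < m`); `A` measurable with `0 < π(A) < 1`;
`p̂_n = (1/n) Σ_{t<n} 1_A(x_t)`.  For EVERY initial law `μ₀` and every real random variable `Y` with law
`N(0, 2 τ_int(ρ_A) π(A)(1 − π(A)))` (`ρ_A = setACF κ π A`, `τ_int` the scorers' `Scoring.tauInt`):
`TendstoInDistribution (fun n x => √n (p̂_n(x) − π(A))) atTop Y (fun _ => P_{μ₀}) P'`. -/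
theorem tendstoInDistribution_indicator_timeAverage_of_nHit (hπ : Kernel.Invariant κ π)
    (hε : ε ≠ 0) (hmin : ∀ z, ε • ν ≤ nHit κ m z) (hm : 0 < m)
    {A : Set S} (hA : MeasurableSet A) (h0 : 0 < π.real A) (h1 : π.real A < 1)
    (μ₀ : Measure S) [IsProbabilityMeasure μ₀]
    {Ω' : Type*} [MeasurableSpace Ω'] {P' : Measure Ω'} [IsProbabilityMeasure P'] {Y : Ω' → ℝ}
    (hY : HasLaw Y (gaussianReal 0
      (Real.toNNReal (2 * Scoring.tauInt (setACF κ π A) * (π.real A * (1 - π.real A))))) P')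
    [IsProbabilityMeasure (Kernel.trajMeasure (X := fun _ : ℕ => S) μ₀
        (fun n : ℕ => κ.comap (fun hh : (i : ↥(Finset.Iic n)) → S => hh ⟨n, Finset.mem_Iic.2 le_rfl⟩)
          (measurable_pi_apply _)))] :
    TendstoInDistribution (fun (n : ℕ) (x : ℕ → S) =>
        Real.sqrt n * ((∑ t ∈ range n, A.indicator (1 : S → ℝ) (x t)) / n - π.real A))
      atTop Y (fun _ => Kernel.trajMeasure (X := fun _ : ℕ => S) μ₀
        (fun n : ℕ => κ.comap (fun hh : (i : ↥(Finset.Iic n)) → S => hh ⟨n, Finset.mem_Iic.2 le_rfl⟩)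
          (measurable_pi_apply _))) P' := by
  have hf : Measurable (A.indicator (1 : S → ℝ)) := measurable_one.indicator hA
  have hC : ∀ x, |A.indicator (1 : S → ℝ) x| ≤ 1 := fun x => by
    by_cases hx : x ∈ A <;> simp [hx]
  rw [← greenKubo_indicator_eq_tauInt hπ hA h0 h1] at hY
  have h := tendstoInDistribution_timeAverage_of_nHit hπ hε hmin hm hf hC μ₀ hY
  rw [integral_indicator_one hA] at h
  have key : (fun (n : ℕ) (x : ℕ → S) =>
      Real.sqrt n * ((∑ t ∈ range n, A.indicator (1 : S → ℝ) (x t)) / n - π.real A))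
      = fun (n : ℕ) (x : ℕ → S) =>
        (Real.sqrt n)⁻¹ * ∑ t ∈ range n, (A.indicator (1 : S → ℝ) (x t) - π.real A) := by
    funext n x
    exact sqrt_mul_mean_sub_eq (fun t => A.indicator (1 : S → ℝ) (x t)) (π.real A) n
  rw [key]
  exact h

/-- The derivative of the logit `p ↦ log(p/(1 − p))` on `(0, 1)` is `1/(p(1 − p))`. -/
theorem hasDerivAt_logit {p : ℝ} (h0 : 0 < p) (h1 : p < 1) :
    HasDerivAt (fun q : ℝ => Real.log (q / (1 - q))) (1 / (p * (1 - p))) p := by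
  have h1' : 0 < 1 - p := sub_pos.2 h1
  have hd : HasDerivAt (fun q : ℝ => q / (1 - q)) ((1 * (1 - p) - p * (0 - 1)) / (1 - p) ^ 2) p :=
    (hasDerivAt_id p).div ((hasDerivAt_const p (1 : ℝ)).sub (hasDerivAt_id p)) h1'.ne'
  have hl := hd.log (div_pos h0 h1').ne'
  convert hl using 1
  field_simp
  ring

/-- **THE LOGIT CLT**: with `ℓ(p) = log(p/(1 − p))`, for every initial law and every
`Y ~ N(0, 2 τ_int(ρ_A) / (π(A)(1 − π(A))))`:
`TendstoInDistribution (fun n x => √n (ℓ(p̂_n(x)) − ℓ(π(A)))) atTop Y (fun _ => P_{μ₀}) P'`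
(delta method at `ℓ'(π(A)) = 1/(π(A)(1 − π(A)))`). -/
theorem tendstoInDistribution_logit_timeAverage_of_nHit (hπ : Kernel.Invariant κ π)
    (hε : ε ≠ 0) (hmin : ∀ z, ε • ν ≤ nHit κ m z) (hm : 0 < m)
    {A : Set S} (hA : MeasurableSet A) (h0 : 0 < π.real A) (h1 : π.real A < 1)
    (μ₀ : Measure S) [IsProbabilityMeasure μ₀]
    {Ω' : Type*} [MeasurableSpace Ω'] {P' : Measure Ω'} [IsProbabilityMeasure P'] {Y : Ω' → ℝ}
    (hY : HasLaw Y (gaussianReal 0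
      (Real.toNNReal (2 * Scoring.tauInt (setACF κ π A) / (π.real A * (1 - π.real A))))) P')
    [IsProbabilityMeasure (Kernel.trajMeasure (X := fun _ : ℕ => S) μ₀
        (fun n : ℕ => κ.comap (fun hh : (i : ↥(Finset.Iic n)) → S => hh ⟨n, Finset.mem_Iic.2 le_rfl⟩)
          (measurable_pi_apply _)))] :
    TendstoInDistribution (fun (n : ℕ) (x : ℕ → S) =>
        Real.sqrt n * (Real.log (((∑ t ∈ range n, A.indicator (1 : S → ℝ) (x t)) / n)
            / (1 - (∑ t ∈ range n, A.indicator (1 : S → ℝ) (x t)) / n))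
          - Real.log (π.real A / (1 - π.real A))))
      atTop Y (fun _ => Kernel.trajMeasure (X := fun _ : ℕ => S) μ₀
        (fun n : ℕ => κ.comap (fun hh : (i : ↥(Finset.Iic n)) → S => hh ⟨n, Finset.mem_Iic.2 le_rfl⟩)
          (measurable_pi_apply _))) P' := by
  have hv0 : 0 < π.real A * (1 - π.real A) := mul_pos h0 (sub_pos.2 h1)
  have hf : Measurable (A.indicator (1 : S → ℝ)) := measurable_one.indicator hA
  -- the rescaled limit variable `Y₀ = v · Y ~ N(0, 2 τ v)`, `v = π(A)(1 − π(A))`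
  have hY₀ : HasLaw (fun ω => (π.real A * (1 - π.real A)) * Y ω) (gaussianReal 0
      (Real.toNNReal (2 * Scoring.tauInt (setACF κ π A) * (π.real A * (1 - π.real A))))) P' := by
    have h := gaussianReal_const_mul hY (π.real A * (1 - π.real A))
    rw [mul_zero] at h
    have hnn : NNReal.mk ((π.real A * (1 - π.real A)) ^ 2) (sq_nonneg _)
        * (2 * Scoring.tauInt (setACF κ π A) / (π.real A * (1 - π.real A))).toNNReal
        = (2 * Scoring.tauInt (setACF κ π A) * (π.real A * (1 - π.real A))).toNNReal := by
      rw [show 2 * Scoring.tauInt (setACF κ π A) * (π.real A * (1 - π.real A))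
          = (π.real A * (1 - π.real A)) ^ 2
            * (2 * Scoring.tauInt (setACF κ π A) / (π.real A * (1 - π.real A))) by
            field_simp,
        Real.toNNReal_mul (sq_nonneg _)]
      congr 1
      apply NNReal.eq
      rw [NNReal.coe_mk, Real.coe_toNNReal _ (sq_nonneg _)]
    rw [hnn] at h
    exact h
  have hclt := tendstoInDistribution_indicator_timeAverage_of_nHit hπ hε hmin hm hA h0 h1 μ₀ hY₀
  -- the delta method at the logit
  have hRm : ∀ n : ℕ, Measurable fun x : ℕ → S =>
      (∑ t ∈ range n, A.indicator (1 : S → ℝ) (x t)) / n := fun n =>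
    (Finset.measurable_sum _ fun t _ => hf.comp (measurable_pi_apply t)).div_const _
  have hae : ∀ᵐ x ∂(Kernel.trajMeasure (X := fun _ : ℕ => S) μ₀
      (fun n : ℕ => κ.comap (fun hh : (i : ↥(Finset.Iic n)) → S => hh ⟨n, Finset.mem_Iic.2 le_rfl⟩)
        (measurable_pi_apply _))),
      Tendsto (fun n : ℕ => (∑ t ∈ range n, A.indicator (1 : S → ℝ) (x t)) / n)
        atTop (𝓝 (π.real A)) := by
    have h := tendsto_sum_div_anyLaw_of_nHit_minorised hπ hε hmin hf
      ((integrable_const (1 : ℝ)).indicator hA) μ₀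
    rw [integral_indicator_one hA] at h
    exact h
  have hφm : Measurable fun q : ℝ => Real.log (q / (1 - q)) :=
    Real.measurable_log.comp (measurable_id.div (measurable_const.sub measurable_id))
  have hder := hasDerivAt_logit h0 h1
  have hdelta := tendstoInDistribution_sqrt_mul_delta hφm hder.differentiableAt hRm hae hclt
  rw [hder.deriv] at hdelta
  have hlim : (fun ω' => 1 / (π.real A * (1 - π.real A)) * ((π.real A * (1 - π.real A)) * Y ω')) = Y := by
    funext ω'
    rw [← mul_assoc, one_div_mul_cancel hv0.ne', one_mul]
  rw [hlim] at hdelta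
  exact hdelta

end EventCLT

end Summit.Ventures.LatticeQCDFlow.Exactness.GeneralNCMC
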